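import Literature.Analysis.SpecialFunctions.DigammaGauss
import Literature.Analysis.SpecialFunctions.DigammaReflection
import Summits.RiemannHypothesis.RiemannHypothesis.Theorems.SoloInformedTentExplicit
import Summits.RiemannHypothesis.RiemannHypothesis.Theorems.SoloInformedLipschitzBombieri
import Summits.RiemannHypothesis.RiemannHypothesis.Theorems.SoloInformedBombieriSeries
import HarnessLib

/-!
# T48 — `W(Δ_t) = Ψ(t)`: Suzuki's Theorem 1.1 (2) through the Weil explicit formula

The named Literature fact `Suzuki2023_thm11_series`
(`∀ t, Σ_ρ m(ρ)(cosh((ρ−½)t) − 1)/(ρ−½)² = Ψ(t)`, used as a hypothesis by T43/T43′/T44) is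
re-proved here through the explicit formula (`hasSum_screw_weilFunctional_tent_abs` +
`weilFunctional_tent_abs_eq_zetaScrew`; the tree's first proof is
`Literature.NumberTheory.LFunctions.Suzuki2023_thm11_series_holds`, via (1.2)). By T46 the series equals `W(Δ_t)` for the tent
`Δ_t`; `W(Δ_t) = 4(e^{t/2}+e^{−t/2}−2) − φ(t) + W_∞(Δ_t)`; by T47 the archimedean term of the
(Lipschitz) tent is Bombieri's `−(log 4π + γ)t/2 − ∫₀^∞ (e^{x/2}(t−x)⁺ − t) dx/(2 sinh x)`; by
T48a the integral is `Σₙ Tₙ` with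
`Tₙ = (e^{−(2n+½)t} − 1)/(2n+½)² + t/(2n+½) − t/(2n+1)` (`integral_tentCore`), and
`Σₙ Tₙ = ¼e^{−t/2}Φ(e^{−2t},2,¼) − ¼ζ(2,¼) + (t/2)(ψ(½) − ψ(¼))` with Gauss's
`ψ(½) − ψ(¼) = π/2 + log 2` (`Complex.digamma_one_half`, `digamma_one_quarter_eq_neg_ofReal`).
Collecting terms gives exactly Suzuki's (1.1), i.e. `zetaScrew_eq`.
-/

noncomputable section

open scoped Real Topology
open Complex Filter Set MeasureTheory Literature.NumberTheory.LFunctions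

namespace Summit.RiemannHypothesis.RiemannHypothesis.Theorems

variable {t : ℝ}

/-! ## Non-vanishing of the denominators -/

/-- `2n + c ≠ 0` in `ℂ` for real `c > 0`. -/
theorem two_mul_natCast_add_ofReal_ne_zero (n : ℕ) {c : ℝ} (hc : 0 < c) :
    (2 * (n : ℂ) + (c : ℂ)) ≠ 0 := by
  have e : (2 * (n : ℂ) + (c : ℂ)) = ((2 * (n : ℝ) + c : ℝ) : ℂ) := by push_cast; ring
  rw [e, Ne, Complex.ofReal_eq_zero]
  positivity

/-- `2n + ½ ≠ 0`. -/
theorem two_mul_natCast_add_half_ne_zero (n : ℕ) : (2 * (n : ℂ) + 1 / 2) ≠ 0 := by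
  have := two_mul_natCast_add_ofReal_ne_zero n (c := 1 / 2) (by norm_num)
  push_cast at this; exact this

/-- `2n + 1 ≠ 0`. -/
theorem two_mul_natCast_add_one_ne_zero' (n : ℕ) : (2 * (n : ℂ) + 1) ≠ 0 := by
  have := two_mul_natCast_add_ofReal_ne_zero n (c := 1) one_pos
  push_cast at this; exact this

/-- `−2n − ½ ≠ 0`. -/
theorem bombieriExponent_ne_zero (n : ℕ) : (-(2 * (n : ℂ)) - 1 / 2) ≠ 0 := by
  rw [show (-(2 * (n : ℂ)) - 1 / 2) = -(2 * (n : ℂ) + 1 / 2) by ring]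
  exact neg_ne_zero.2 (two_mul_natCast_add_half_ne_zero n)

/-- `n + c ≠ 0` in `ℂ` for real `c > 0`. -/
theorem natCast_add_ofReal_ne_zero (n : ℕ) {c : ℝ} (hc : 0 < c) : ((n : ℂ) + (c : ℂ)) ≠ 0 := by
  have e : ((n : ℂ) + (c : ℂ)) = (((n : ℝ) + c : ℝ) : ℂ) := by push_cast; ring
  rw [e, Ne, Complex.ofReal_eq_zero]
  positivity

/-! ## The Bombieri terms of the tent -/

/-- The Bombieri numerator of the symmetrised tent is `O(x)` on `[0,1]` (Lipschitz bound, T47). -/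
theorem exists_norm_tent_bombieriNumerator_le (ht : 0 ≤ t) :
    ∃ M : ℝ, 0 ≤ M ∧ ∀ x ∈ Icc (0 : ℝ) 1,
      ‖(Real.exp (x / 2) : ℂ) * (tent t x + tent t (-x)) - (tent t 0 + tent t (-0))‖ ≤ M * x := by
  have hL : ∀ a b : ℝ, ‖tent t a - tent t b‖ ≤ 1 / 2 * |a - b| := fun a b ↦ by
    have := norm_tent_sub_le t a b; linarith
  have hK : ‖tent t 0‖ ≤ t / 2 := norm_tent_le ht 0
  refine ⟨(2 * (1 / 2) + t / 2) * Real.exp (1 / 2), by positivity, fun x hx ↦ ?_⟩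
  obtain ⟨hx0, hx1⟩ := hx
  have h := norm_bombieriNumerator_le_of_lipschitz hL hK hx0
  have e2 : tent t 0 + tent t (-0) = 2 * tent t 0 := by rw [neg_zero, two_mul]
  rw [e2]
  have hc : 0 ≤ (2 * (1 / 2) + t / 2) * x := by positivity
  calc ‖(Real.exp (x / 2) : ℂ) * (tent t x + tent t (-x)) - 2 * tent t 0‖
      ≤ (2 * (1 / 2) + t / 2) * x * Real.exp (x / 2) := h
    _ ≤ (2 * (1 / 2) + t / 2) * x * Real.exp (1 / 2) :=
        mul_le_mul_of_nonneg_left (Real.exp_le_exp.2 (by linarith)) hc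
    _ = (2 * (1 / 2) + t / 2) * Real.exp (1 / 2) * x := by ring

/-- `∫₀^∞ (Δ_t(x) + Δ_t(−x)) e^{wx} dx = (e^{wt} − 1 − wt)/w²` (`w ≠ 0`, `t ≥ 0`): the integrand is
`(t − x)e^{wx}` on `(0, t]` and vanishes beyond (`integral_tentCore`). -/
theorem integral_tent_symm_mul_exp (ht : 0 ≤ t) {w : ℂ} (hw : w ≠ 0) :
    ∫ x in Ioi (0 : ℝ), (tent t x + tent t (-x)) * cexp (w * x) =
      (cexp (w * t) - 1 - w * t) / w ^ 2 := by
  rw [← integral_tentCore t hw, intervalIntegral.integral_of_le ht,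
    setIntegral_eq_of_subset_of_forall_sdiff_eq_zero measurableSet_Ioi Ioc_subset_Ioi_self]
  · refine setIntegral_congr_fun measurableSet_Ioc fun x hx ↦ ?_
    rw [tent_neg, tent_of_mem_Icc ⟨hx.1.le, hx.2⟩]
    ring
  · rintro x ⟨hx0, hx'⟩
    rw [mem_Ioi] at hx0
    have hxt : t < x := by
      by_contra h
      exact hx' ⟨hx0, not_lt.1 h⟩
    rw [tent_neg, tent_eq_zero_of_lt (by rwa [abs_of_pos hx0])]
    simp

/-- The `n`-th Bombieri term of the tent:
`Tₙ(t) = (e^{−(2n+½)t} − 1)/(2n+½)² + t/(2n+½) − t/(2n+1)`. -/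
def tentBombieriTerm (t : ℝ) (n : ℕ) : ℂ :=
  (cexp ((-(2 * (n : ℂ)) - 1 / 2) * t) - 1) / (2 * (n : ℂ) + 1 / 2) ^ 2 +
    (t : ℂ) / (2 * (n : ℂ) + 1 / 2) - (t : ℂ) / (2 * (n : ℂ) + 1)

/-- **Bombieri's integral of the tent as a series** (T48a applied to `Δ_t(x) + Δ_t(−x)`):
`∫₀^∞ (e^{x/2}(Δ_t(x)+Δ_t(−x)) − 2Δ_t(0)) dx/(2 sinh x) = Σₙ Tₙ(t)`. -/
theorem hasSum_tentBombieriTerm_integral (ht : 0 ≤ t) :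
    HasSum (tentBombieriTerm t)
      (∫ x in Ioi (0 : ℝ), ((Real.exp (x / 2) : ℂ) * (tent t x + tent t (-x)) - 2 * tent t 0) /
        (2 * Real.sinh x : ℂ)) := by
  have hc := continuous_tent t
  have hkc : Continuous fun x : ℝ ↦ tent t x + tent t (-x) := by fun_prop
  have hks : HasCompactSupport fun x : ℝ ↦ tent t x + tent t (-x) :=
    HasCompactSupport.intro (isCompact_Icc (a := -t) (b := t)) fun x hx ↦ by
      rw [tent_neg, tent_eq_zero_of_not_mem hx, add_zero]
  have h := hasSum_bombieriIntegral_of_le hkc hks (exists_norm_tent_bombieriNumerator_le ht)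
  have e2 : tent t 0 + tent t (-0) = 2 * tent t 0 := by rw [neg_zero, two_mul]
  simp only [e2] at h
  have ef : tentBombieriTerm t = fun n : ℕ ↦
      (∫ x in Ioi (0 : ℝ), (tent t x + tent t (-x)) * cexp ((-(2 * (n : ℂ)) - 1 / 2) * x)) -
        2 * tent t 0 / (2 * (n : ℂ) + 1) := by
    funext n
    rw [integral_tent_symm_mul_exp ht (bombieriExponent_ne_zero n), tent_zero t ht,
      tentBombieriTerm]
    have hβ := two_mul_natCast_add_half_ne_zero n
    have hγ := two_mul_natCast_add_one_ne_zero' n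
    have hw := bombieriExponent_ne_zero n
    field_simp
    ring
  rw [ef]
  exact h

/-! ## Summing the series -/

/-- `Σₙ e^{−(2n+½)t}/(2n+½)² = ¼ e^{−t/2} Φ(e^{−2t}, 2, ¼)` (`t ≥ 0`). -/
theorem hasSum_tent_expTerm (ht : 0 ≤ t) :
    HasSum (fun n : ℕ ↦ cexp ((-(2 * (n : ℂ)) - 1 / 2) * t) / (2 * (n : ℂ) + 1 / 2) ^ 2)
      ((1 / 4 : ℂ) * (Real.exp (-(t / 2)) : ℂ) * (hurwitzLerchQuarter t : ℂ)) := by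
  have h0 : HasSum (fun k : ℕ ↦ Real.exp (-(2 * |t| * k)) / ((k : ℝ) + 1 / 4) ^ 2)
      (hurwitzLerchQuarter t) := (summable_hurwitzLerchQuarter t).hasSum
  have h1 := (Complex.hasSum_ofReal.2 h0).mul_left ((1 / 4 : ℂ) * (Real.exp (-(t / 2)) : ℂ))
  simp only [abs_of_nonneg ht] at h1
  refine h1.congr_fun fun n ↦ ?_
  have hβ := two_mul_natCast_add_half_ne_zero n
  have hk : ((n : ℂ) + 1 / 4) ≠ 0 := by
    have := natCast_add_ofReal_ne_zero n (c := 1 / 4) (by norm_num)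
    push_cast at this; exact this
  have he : cexp ((-(2 * (n : ℂ)) - 1 / 2) * t) =
      (Real.exp (-(t / 2)) : ℂ) * (Real.exp (-(2 * t * n)) : ℂ) := by
    rw [Complex.ofReal_exp, Complex.ofReal_exp, ← Complex.exp_add]
    push_cast
    ring_nf
  rw [he]
  push_cast
  field_simp
  ring

/-- `Σₙ 1/(2n+½)² = ¼ ζ(2, ¼) = ¼ Σ_k (k+¼)^{−2}`. -/
theorem hasSum_tent_constTerm :
    HasSum (fun n : ℕ ↦ 1 / (2 * (n : ℂ) + 1 / 2) ^ 2)
      ((1 / 4 : ℂ) * ((∑' k : ℕ, 1 / ((k : ℝ) + 1 / 4) ^ 2 : ℝ) : ℂ)) := by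
  have h0 := summable_one_div_nat_add_quarter_sq.hasSum
  have h1 := (Complex.hasSum_ofReal.2 h0).mul_left (1 / 4 : ℂ)
  refine h1.congr_fun fun n ↦ ?_
  have hβ := two_mul_natCast_add_half_ne_zero n
  have hk : ((n : ℂ) + 1 / 4) ≠ 0 := by
    have := natCast_add_ofReal_ne_zero n (c := 1 / 4) (by norm_num)
    push_cast at this; exact this
  push_cast
  field_simp
  ring

/-- `Σₙ (t/(2n+½) − t/(2n+1)) = (t/2)(ψ(½) − ψ(¼))` (Gauss's digamma series). -/
theorem hasSum_tent_linearTerm (t : ℝ) :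
    HasSum (fun n : ℕ ↦ (t : ℂ) / (2 * (n : ℂ) + 1 / 2) - (t : ℂ) / (2 * (n : ℂ) + 1))
      ((t : ℂ) / 2 * (Complex.digamma (1 / 2) - Complex.digamma (1 / 4))) := by
  have hq := Literature.Analysis.SpecialFunctions.Complex.hasSum_one_div_sub_one_div_digamma
    (w := ((1 / 4 : ℝ) : ℂ)) (by rw [Complex.ofReal_re]; norm_num)
  have hh := Literature.Analysis.SpecialFunctions.Complex.hasSum_one_div_sub_one_div_digamma
    (w := ((1 / 2 : ℝ) : ℂ)) (by rw [Complex.ofReal_re]; norm_num)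
  push_cast at hq hh
  have h := (hh.sub hq).mul_left ((t : ℂ) / 2)
  have hv : (t : ℂ) / 2 * ((Complex.digamma (1 / 2) + (Real.eulerMascheroniConstant : ℂ)) -
      (Complex.digamma (1 / 4) + (Real.eulerMascheroniConstant : ℂ))) =
      (t : ℂ) / 2 * (Complex.digamma (1 / 2) - Complex.digamma (1 / 4)) := by ring
  rw [hv] at h
  refine h.congr_fun fun n ↦ ?_
  have e1 : (t : ℂ) / (2 * (n : ℂ) + 1 / 2) = (t : ℂ) / 2 * (1 / (1 / 4 + (n : ℂ))) := by
    rw [mul_one_div, div_div]; congr 1; ring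
  have e2 : (t : ℂ) / (2 * (n : ℂ) + 1) = (t : ℂ) / 2 * (1 / (1 / 2 + (n : ℂ))) := by
    rw [mul_one_div, div_div]; congr 1; ring
  rw [e1, e2]
  ring

/-- **The sum of the Bombieri terms of the tent**:
`Σₙ Tₙ(t) = ¼e^{−t/2}Φ(e^{−2t},2,¼) − ¼ζ(2,¼) + (t/2)(ψ(½) − ψ(¼))`. -/
theorem hasSum_tentBombieriTerm (ht : 0 ≤ t) :
    HasSum (tentBombieriTerm t)
      ((1 / 4 : ℂ) * (Real.exp (-(t / 2)) : ℂ) * (hurwitzLerchQuarter t : ℂ) -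
        (1 / 4 : ℂ) * ((∑' k : ℕ, 1 / ((k : ℝ) + 1 / 4) ^ 2 : ℝ) : ℂ) +
        (t : ℂ) / 2 * (Complex.digamma (1 / 2) - Complex.digamma (1 / 4))) := by
  have h := ((hasSum_tent_expTerm ht).sub hasSum_tent_constTerm).add (hasSum_tent_linearTerm t)
  refine h.congr_fun fun n ↦ ?_
  rw [tentBombieriTerm]
  ring

/-! ## `W(Δ_t) = Ψ(t)` and Suzuki's Theorem 1.1 (2) -/

/-- **`W(Δ_t) = Ψ(t)`** for `t ≥ 0`: the Weil functional of the tent is Suzuki's screw function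
(1.1) (`zetaScrew_eq`), the constant `γ + π/2 + 3 log 2 + log π = −ψ(¼) + log π` coming from
`log 4π + γ + (ψ(½) − ψ(¼))… ` via Gauss's `ψ(½) = −γ − 2 log 2`, `ψ(¼) = −γ − π/2 − 3 log 2`. -/
theorem weilFunctional_tent_eq_zetaScrew (ht : 0 ≤ t) :
    weilFunctional (tent t) = (zetaScrew t : ℂ) := by
  have hL : ∀ x y : ℝ, ‖tent t x - tent t y‖ ≤ 1 / 2 * |x - y| := fun x y ↦ by
    have := norm_tent_sub_le t x y; linarith
  have hI := (hasSum_tentBombieriTerm_integral ht).unique (hasSum_tentBombieriTerm ht)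
  rw [weilFunctional_tent ht, ← weilArchTermBombieri_eq_weilArchTerm_of_lipschitz
    (continuous_tent t) (hasCompactSupport_tent t) hL (integrable_weilMellin_tent_digamma ht)]
  unfold weilArchTermBombieri
  rw [hI, tent_zero t ht, zetaScrew_eq, abs_of_nonneg ht, Complex.digamma_one_half,
    Literature.Analysis.SpecialFunctions.Complex.digamma_one_quarter_eq_neg_ofReal]
  have hlog4pi : Real.log (4 * π) = 2 * Real.log 2 + Real.log π := by
    rw [Real.log_mul (by norm_num) Real.pi_pos.ne', show (4 : ℝ) = 2 ^ 2 by norm_num,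
      Real.log_pow]
    push_cast
    ring
  have hlog2 : Complex.log 2 = (Real.log 2 : ℂ) := by
    rw [Complex.ofReal_log zero_le_two]
    norm_num
  rw [hlog4pi, hlog2]
  generalize (∑' k : ℕ, 1 / ((k : ℝ) + 1 / 4) ^ 2) = C
  generalize hurwitzLerchQuarter t = Φ
  generalize Real.exp (t / 2) = E₁
  generalize Real.exp (-(t / 2)) = E₂
  generalize zetaScrewPrimeSum t = P
  push_cast
  ring

/-- **`W(Δ_{|t|}) = Ψ(t)`** for every real `t` (`Ψ` is even). -/
theorem weilFunctional_tent_abs_eq_zetaScrew (t : ℝ) :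
    weilFunctional (tent |t|) = (zetaScrew t : ℂ) := by
  rw [weilFunctional_tent_eq_zetaScrew (abs_nonneg t), zetaScrew_abs]

/-- **Suzuki's series is the Weil functional of the tent**: for every real `t`,
`Σ_ρ m(ρ)(cosh((ρ−½)t) − 1)/(ρ−½)² = W(Δ_{|t|})`. Together with
`weilFunctional_tent_abs_eq_zetaScrew` this is a second, explicit-formula proof of Suzuki2023
Thm 1.1 (2) (`Suzuki2023_thm11_series`; the tree's first proof,
`Literature.NumberTheory.LFunctions.Suzuki2023_thm11_series_holds`, goes through the Laplace
transform (1.2) and the Hadamard product as in Suzuki2023 §2.2). -/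
theorem hasSum_screw_weilFunctional_tent_abs (t : ℝ) :
    HasSum (fun ρ : ZetaZeros.riemannZetaNontrivialZeros ↦
      (riemannZetaZeroOrder (ρ : ℂ) : ℂ) *
        ((Complex.cosh (((ρ : ℂ) - 1 / 2) * t) - 1) / ((ρ : ℂ) - 1 / 2) ^ 2))
      (weilFunctional (tent |t|)) := by
  rcases le_or_gt 0 t with ht | ht
  · rw [abs_of_nonneg ht]
    exact hasSum_screw_weilFunctional_tent ht
  · have h := hasSum_screw_weilFunctional_tent (t := -t) (by linarith)
    rw [abs_of_neg ht]
    simpa only [Complex.ofReal_neg, mul_neg, Complex.cosh_neg] using h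

/-- **Suzuki2023 Thm 1.1 (2) via the explicit formula** (second proof): the named fact
`Suzuki2023_thm11_series`, obtained here from `W(Δ_{|t|}) = Ψ(t)`; stated as an equality of the
series' value with `Ψ` through `HasSum.unique` to avoid restating the tree's theorem. -/
theorem zetaScrew_eq_tsum_screw (t : ℝ) :
    (zetaScrew t : ℂ) = ∑' ρ : ZetaZeros.riemannZetaNontrivialZeros,
      (riemannZetaZeroOrder (ρ : ℂ) : ℂ) *
        ((Complex.cosh (((ρ : ℂ) - 1 / 2) * t) - 1) / ((ρ : ℂ) - 1 / 2) ^ 2) := by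
  rw [← weilFunctional_tent_abs_eq_zetaScrew, (hasSum_screw_weilFunctional_tent_abs t).tsum_eq]

end Summit.RiemannHypothesis.RiemannHypothesis.Theorems

end
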